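import Summits.QuantumFields.YangMills.Theorems.BalabanUVNodesN15FullPropagatorExactSiteSocket
import Summits.QuantumFields.YangMills.Theorems.BalabanUVNodesN15UnitLayerBgIncrementLetters

/-!
# Route «BalabanUVNodes», cluster K4 «SpineRates» — node N15 = NE2: THE SITE LAYER WITH THE BACKGROUND LIVE IN THE TwoGrid ENTRY CURRENCY, III — THE KNIT WITH EVERY LAYER
# READING `U`, THE UNIT LETTERS IN THE PRODUCERS' OWN CURRENCY (dag-n15-a V-G's three INCREMENT letters of `W = E − G`) AND THE SITE LETTERS OF PART II

Cell `pub-ymgap`, WIDTH SEAT `pub-ymgap-dag-n15-w1` (generation 0; director-ym №197 ∕ HUMAN RULING D-0149; chair R455 (A) ∕ R461; plan g77 `W-SEAT-START-LIST.md` §2 n15 ITEM 1 —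
bus CLAIM pub-ymgap INBOX l.24149).  `bears_on: R4∕N15 · K3⁷ SpineGivenEndpointR13SepCoPH (stmt-QuantumFields-20544)`.  Filed `--kind proof --supports stmt-QuantumFields-20544
--as helper` — COUNT-NEUTRAL.  THEOREMS ONLY (0 `def`, 0 `sorry`).  Imports this seat's part II `…N15FullPropagatorExactSiteSocket` (`tgSiteExOn`, `ne2PlusSite_tgSiteExOn_of_letters`,
`s_N15_of_admits_tgExEx_of_ne2PlusOperator`'s pattern) and dag-n15-a V-G `…N15UnitLayerBgIncrementLetters` (p583303: `zLetters_of_incrementLetters`, `ne2PlusUnit_tgCovExOn_of_incrementLetters`,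
`n15At_tgEx_of_incrementLetters` — whose SITE layer is still part 78's U-blind `tgSiteOn`); nothing in the tree is modified.

WHY.  V-G is the form the operator-layer producers consume: its unit letters are the three INCREMENT letters of `W(U) = E(U) − G` ((L1) size, (L2) two-grid defect, (L3)
η-gradient, `HasMaj` over King's blocks) that every dressed-propagator construction of dag-n15-b∕-c proves en route; its knit `n15At_tgEx_of_incrementLetters` has the SITE layer
U-blind.  THIS FILE is V-G's knit with part II's U-seeing site socket in place of `tgSiteOn`: from an operator layer BY NAME, the three increment letters `hW` and part II's three site
letters `hP`, `N15At` with EVERY layer reading the configuration — and its face at any keyed rate home (dag-n15-a part 30's interface).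

CONTENTS.  ★★★ `n15At_tgExEx_of_incrementLetters`; ★★ `s_N15_of_admits_tgExEx_of_incrementLetters`.

HONEST FRAMING.  Count-neutral composition BY NAME (part II + V-G); `hop`, `hW`, `hP` are HYPOTHESES (the zero increment and the zero site perturbation inhabit `hW`∕`hP` and give
back the `U ≡ 1` layers; U-seeing inhabitants = a dressed-propagator species (dag-n15-c's lane) resp. the LOCATED site-perturbation species of part II's header); model level wherever
instantiated; NOT [B9] Thms 3.1∕3.2∕3.15 at a general (3.35)-regular `U` (NE2⁺ NOT PRINTED as η-rates); Node 00's [B9] layers of record are residual — **N15 is NOT discharged**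
(typed 28∕28 · discharged 5∕27 of record unchanged); one finite four-torus programme at fixed `ε` — NOT ℝ⁴, NOT infinite volume, NOT OS, NOT a mass gap, NOT Clay; R4 closes the
conditional finite-𝕋⁴ rung `BalabanLadder.UV` only.  Restate-immune (no Theses import).
-/

set_option autoImplicit false

noncomputable section

open scoped BigOperators Matrix
open Finset

namespace Summit.QuantumFields.YangMills.BalabanUVNodes.N15.SiteLayerBg

open Literature.MathematicalPhysics.QuantumFieldTheory.Balaban1983to89
open Literature.MathematicalPhysics.QuantumFieldTheory.Balaban1983to89.B11SectG (BlockNorm HasMaj)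
open Literature.MathematicalPhysics.QuantumFieldTheory.Balaban1983to89.T4Continuum (T4Family ULoop)
open Literature.MathematicalPhysics.QuantumFieldTheory.Balaban1983to89.T4EtaRate (PairedInstance EtaPairing NE2PlusOperator NE2PlusSite NE2PlusUnit)
open Literature.MathematicalPhysics.QuantumFieldTheory.Balaban1983to89.T4EtaRateDefect (idef)
open Literature.MathematicalPhysics.QuantumFieldTheory.Balaban1983to89.T4EtaRateCoeffDefect (pull)
open Literature.MathematicalPhysics.QuantumFieldTheory.Balaban1983to89.B5Prop11Plancherel (Tor fine)
open Literature.MathematicalPhysics.QuantumFieldTheory.Balaban1983to89.B4Sect5Torus (tdist)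
open Literature.MathematicalPhysics.QuantumFieldTheory.Balaban1983to89.B5QGGQ145Bounds (Idx)
open Literature.MathematicalPhysics.QuantumFieldTheory.Balaban1983to89.B6UnitTorusCarrier (unitTorusGeo)
open Literature.MathematicalPhysics.QuantumFieldTheory.King1986.Torus (blockOf tdistT)
open Node00 (NE2Objects₁₁)
open Summit.QuantumFields.YangMills.BalabanUVNodes.N15.TwoGrid (symbOp sD qvRe qvAdjRe TGIndex tgGeoC)
open Summit.QuantumFields.YangMills.BalabanUVNodes.N15.VectorPiece (blkFine kingPrV)
open Summit.QuantumFields.YangMills.BalabanUVNodes.N15.UnitLayerBg (tgCovExOn unitBondMat zLetters_of_incrementLetters ne2PlusUnit_tgCovExOn_of_incrementLetters)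
open Summit.QuantumFields.YangMills.BalabanUVNodes.N15.AtKeyedHome (s_N15_of_admits)
open YMDAG.UVSplit (Datum RateCarriers RateRecordPred N15At S_N15 ne2OfRecord₁₁)

variable {d : ℕ} {L : ℕ} [NeZero L] {I : Type} (ι : I → TGIndex) (gf : I → B9.Geometry) (Bc Bf : I → B9.Backgrounds)

/-- ★★★ **`N15At` WITH EVERY LAYER READING `U`, FROM AN OPERATOR LAYER BY NAME, THE THREE INCREMENT LETTERS (unit) AND THE THREE SITE LETTERS (site)** — dag-n15-a V-G's
`n15At_tgEx_of_incrementLetters` with part II's `tgSiteExOn` in place of the U-blind `tgSiteOn`: OPERATOR = `hop`; UNIT = V-G `ne2PlusUnit_tgCovExOn_of_incrementLetters` (`hW`: (L1) size of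
`W(Ū)`, `W′(U)`, (L2) two-grid defect `𝔇(W′(U), W(Ū))`, (L3) η-gradient of `W(Ū)`, as `HasMaj` over King's blocks; the middle factors are `unitBondMat (Q W Q*)`); SITE = part II
`ne2PlusSite_tgSiteExOn_of_letters` (`hP`). [bookkeeping] -/
theorem n15At_tgExEx_of_incrementLetters (hd : 1 ≤ d) (hLodd : Odd L) (hL2 : 2 ≤ L) (hL : Odd L ∧ 1 < L) {b aS : ℝ} (hb : 0 < b) (haS : 0 < aS) (α β : Fin (d + 1))
    (hι : ∀ i, 1 ≤ (ι i).mT) (hM : ∀ i, 1 ≤ (gf i).M) (pair : ∀ i, EtaPairing (tgGeoC d hL (ι i)) (gf i) (Bc i) (Bf i)) {c35 : ℝ} (p : ℝ)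
    (Kop : ∀ i, B9.KernelFamily (tgGeoC d hL (ι i)) (Bf i))
    (hop : NE2PlusOperator c35 (fun i => (⟨tgGeoC d hL (ι i), gf i, Bc i, Bf i, pair i⟩ : PairedInstance)) Kop)
    (Wf : ∀ i, (Bf i).Cfg → (Tor (fine (L ^ (ι i).m * L ^ (ι i).k) (TGIndex.Mn d hL (ι i))) × Fin (d + 1) → ℝ) →ₗ[ℝ]
      (Tor (fine (L ^ (ι i).m * L ^ (ι i).k) (TGIndex.Mn d hL (ι i))) × Fin (d + 1) → ℝ))
    (Wc : ∀ i, (Bc i).Cfg → (Tor (fine (L ^ (ι i).k) (TGIndex.Mn d hL (ι i))) × Fin (d + 1) → ℝ) →ₗ[ℝ] (Tor (fine (L ^ (ι i).k) (TGIndex.Mn d hL (ι i))) × Fin (d + 1) → ℝ))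
    {θZ : ℝ} (hθL : (L : ℝ)⁻¹ ≤ θZ) (hθ1 : θZ < 1)
    (hW : ∃ βW mW βD ρ a₁ : ℝ, 0 < βW ∧ 0 < mW ∧ 0 < βD ∧ 0 < ρ ∧ 0 < a₁ ∧
      ∀ (i : I) (α₀ : ℝ), 0 < α₀ → α₀ ≤ a₁ → ∀ U : (Bf i).Cfg, (Bf i).Reg335 c35 α₀ U →
        HasMaj (BlockNorm.ofBlocks (unitTorusGeo L (ι i).k (TGIndex.Mn d hL (ι i))) (blkFine L (ι i).k (TGIndex.Mn d hL (ι i))))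
          (BlockNorm.ofBlocks (unitTorusGeo L (ι i).k (TGIndex.Mn d hL (ι i))) (blkFine L (ι i).k (TGIndex.Mn d hL (ι i)))) (Wc i ((pair i).avg U))
          (fun y y' => βW * α₀ * Real.exp (-(ρ * tdistT (TGIndex.Mn d hL (ι i)) y y'))) ∧
        HasMaj (BlockNorm.ofBlocks (unitTorusGeo L (ι i).k (TGIndex.Mn d hL (ι i))) (fun x : Tor (fine (L ^ (ι i).m * L ^ (ι i).k) (TGIndex.Mn d hL (ι i))) × Fin (d + 1) =>
            blockOf (L ^ (ι i).m * L ^ (ι i).k) (TGIndex.Mn d hL (ι i)) x.1))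
          (BlockNorm.ofBlocks (unitTorusGeo L (ι i).k (TGIndex.Mn d hL (ι i))) (fun x : Tor (fine (L ^ (ι i).m * L ^ (ι i).k) (TGIndex.Mn d hL (ι i))) × Fin (d + 1) =>
            blockOf (L ^ (ι i).m * L ^ (ι i).k) (TGIndex.Mn d hL (ι i)) x.1)) (Wf i U)
          (fun y y' => βW * α₀ * Real.exp (-(ρ * tdistT (TGIndex.Mn d hL (ι i)) y y'))) ∧
        HasMaj (BlockNorm.ofBlocks (unitTorusGeo L (ι i).k (TGIndex.Mn d hL (ι i))) (blkFine L (ι i).k (TGIndex.Mn d hL (ι i))))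
          (BlockNorm.ofBlocks (unitTorusGeo L (ι i).k (TGIndex.Mn d hL (ι i))) (fun x : Tor (fine (L ^ (ι i).m * L ^ (ι i).k) (TGIndex.Mn d hL (ι i))) × Fin (d + 1) =>
            blockOf (L ^ (ι i).m * L ^ (ι i).k) (TGIndex.Mn d hL (ι i)) x.1))
          (idef (pull (kingPrV L (ι i).k (ι i).m (TGIndex.Mn d hL (ι i)))) (pull (kingPrV L (ι i).k (ι i).m (TGIndex.Mn d hL (ι i)))) (Wf i U) (Wc i ((pair i).avg U)))
          (fun y y' => mW * θZ ^ (ι i).k * Real.exp (-(ρ * tdistT (TGIndex.Mn d hL (ι i)) y y'))) ∧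
        (∀ κ : Fin (d + 1), HasMaj (BlockNorm.ofBlocks (unitTorusGeo L (ι i).k (TGIndex.Mn d hL (ι i))) (blkFine L (ι i).k (TGIndex.Mn d hL (ι i))))
          (BlockNorm.ofBlocks (unitTorusGeo L (ι i).k (TGIndex.Mn d hL (ι i))) (blkFine L (ι i).k (TGIndex.Mn d hL (ι i))))
          (symbOp (TGIndex.Mn d hL (ι i)) (L ^ (ι i).k) (sD (TGIndex.Mn d hL (ι i)) (L ^ (ι i).k) κ ((L ^ (ι i).k : ℕ) : ℝ)) ∘ₗ Wc i ((pair i).avg U))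
          (fun y y' => βD * α₀ * Real.exp (-(ρ * tdistT (TGIndex.Mn d hL (ι i)) y y')))))
    (Pf : ∀ i, (Bf i).Cfg → Matrix (Idx (TGIndex.Mn d hL (ι i))) (Idx (TGIndex.Mn d hL (ι i))) ℝ)
    (Pc : ∀ i, (Bc i).Cfg → Matrix (Idx (TGIndex.Mn d hL (ι i))) (Idx (TGIndex.Mn d hL (ι i))) ℝ) {γP : ℝ} (hγP : 0 < γP)
    (hP : ∃ δP ζ τ a₁ : ℝ, 0 < δP ∧ 0 < ζ ∧ 0 < τ ∧ 0 < a₁ ∧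
      ∀ (i : I) (α₀ : ℝ), 0 < α₀ → α₀ ≤ a₁ → ∀ U : (Bf i).Cfg, (Bf i).Reg335 c35 α₀ U →
        (∀ p q : Idx (TGIndex.Mn d hL (ι i)), |Pc i ((pair i).avg U) p q| ≤ ζ * α₀ * Real.exp (-(δP * tdist (TGIndex.Mn d hL (ι i)) p q))) ∧
        (∀ p q : Idx (TGIndex.Mn d hL (ι i)), |Pf i U p q| ≤ ζ * α₀ * Real.exp (-(δP * tdist (TGIndex.Mn d hL (ι i)) p q))) ∧
        (∀ p q : Idx (TGIndex.Mn d hL (ι i)), |Pf i U p q - Pc i ((pair i).avg U) p q|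
            ≤ τ * ((L : ℝ) ^ (ι i).k) ^ (-γP) * Real.exp (-(δP * tdist (TGIndex.Mn d hL (ι i)) p q)))) :
    N15At { I := I, c35 := c35, p := p, pi := fun i => ⟨tgGeoC d hL (ι i), gf i, Bc i, Bf i, pair i⟩, Kop := Kop,
            Ksite := tgSiteExOn ι gf Bc Bf d hL aS pair Pf Pc,
            Kunit := tgCovExOn ι gf Bc Bf d hL b α β pair
              (fun i U => unitBondMat (TGIndex.Mn d hL (ι i)) (qvRe _ (L ^ (ι i).m * L ^ (ι i).k) ∘ₗ (Wf i U ∘ₗ qvAdjRe _ (L ^ (ι i).m * L ^ (ι i).k))))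
              (fun i V => unitBondMat (TGIndex.Mn d hL (ι i)) (qvRe _ (L ^ (ι i).k) ∘ₗ (Wc i V ∘ₗ qvAdjRe _ (L ^ (ι i).k)))),
            inΛ := fun _ _ => True, unitDist := fun i => (tgGeoC d hL (ι i)).dist } :=
  ⟨hop, ne2PlusSite_tgSiteExOn_of_letters (d := d) ι gf Bc Bf hLodd hL2 hL haS c35 4 p hM pair Pf Pc hγP hP,
   ne2PlusUnit_tgCovExOn_of_incrementLetters (d := d) ι gf Bc Bf hd hL2 hL hb c35 α β hι hM pair Wf Wc hθL hθ1 hW⟩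

variable {N : ℕ} [NeZero N] {key : (F : T4Family) → Datum F N → Prop}

/-- ★★ **THE SAME KNIT AT ANY KEYED RATE HOME** (dag-n15-a part 30's interface): a home `RRec` over ANY key admitting only the literals of a key-indexed NE2 reading whose value
everywhere is the knitted bundle of `n15At_tgExEx_of_incrementLetters` has `S_N15 RRec`. [bookkeeping] -/
theorem s_N15_of_admits_tgExEx_of_incrementLetters (hd : 1 ≤ d) (hLodd : Odd L) (hL2 : 2 ≤ L) (hL : Odd L ∧ 1 < L) {b aS : ℝ} (hb : 0 < b) (haS : 0 < aS)
    (α β : Fin (d + 1)) (hι : ∀ i, 1 ≤ (ι i).mT) (hM : ∀ i, 1 ≤ (gf i).M) (pair : ∀ i, EtaPairing (tgGeoC d hL (ι i)) (gf i) (Bc i) (Bf i)) {c35 : ℝ} (p : ℝ)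
    (Kop : ∀ i, B9.KernelFamily (tgGeoC d hL (ι i)) (Bf i))
    (hop : NE2PlusOperator c35 (fun i => (⟨tgGeoC d hL (ι i), gf i, Bc i, Bf i, pair i⟩ : PairedInstance)) Kop)
    (Wf : ∀ i, (Bf i).Cfg → (Tor (fine (L ^ (ι i).m * L ^ (ι i).k) (TGIndex.Mn d hL (ι i))) × Fin (d + 1) → ℝ) →ₗ[ℝ]
      (Tor (fine (L ^ (ι i).m * L ^ (ι i).k) (TGIndex.Mn d hL (ι i))) × Fin (d + 1) → ℝ))
    (Wc : ∀ i, (Bc i).Cfg → (Tor (fine (L ^ (ι i).k) (TGIndex.Mn d hL (ι i))) × Fin (d + 1) → ℝ) →ₗ[ℝ] (Tor (fine (L ^ (ι i).k) (TGIndex.Mn d hL (ι i))) × Fin (d + 1) → ℝ))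
    {θZ : ℝ} (hθL : (L : ℝ)⁻¹ ≤ θZ) (hθ1 : θZ < 1)
    (hW : ∃ βW mW βD ρ a₁ : ℝ, 0 < βW ∧ 0 < mW ∧ 0 < βD ∧ 0 < ρ ∧ 0 < a₁ ∧
      ∀ (i : I) (α₀ : ℝ), 0 < α₀ → α₀ ≤ a₁ → ∀ U : (Bf i).Cfg, (Bf i).Reg335 c35 α₀ U →
        HasMaj (BlockNorm.ofBlocks (unitTorusGeo L (ι i).k (TGIndex.Mn d hL (ι i))) (blkFine L (ι i).k (TGIndex.Mn d hL (ι i))))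
          (BlockNorm.ofBlocks (unitTorusGeo L (ι i).k (TGIndex.Mn d hL (ι i))) (blkFine L (ι i).k (TGIndex.Mn d hL (ι i)))) (Wc i ((pair i).avg U))
          (fun y y' => βW * α₀ * Real.exp (-(ρ * tdistT (TGIndex.Mn d hL (ι i)) y y'))) ∧
        HasMaj (BlockNorm.ofBlocks (unitTorusGeo L (ι i).k (TGIndex.Mn d hL (ι i))) (fun x : Tor (fine (L ^ (ι i).m * L ^ (ι i).k) (TGIndex.Mn d hL (ι i))) × Fin (d + 1) =>
            blockOf (L ^ (ι i).m * L ^ (ι i).k) (TGIndex.Mn d hL (ι i)) x.1))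
          (BlockNorm.ofBlocks (unitTorusGeo L (ι i).k (TGIndex.Mn d hL (ι i))) (fun x : Tor (fine (L ^ (ι i).m * L ^ (ι i).k) (TGIndex.Mn d hL (ι i))) × Fin (d + 1) =>
            blockOf (L ^ (ι i).m * L ^ (ι i).k) (TGIndex.Mn d hL (ι i)) x.1)) (Wf i U)
          (fun y y' => βW * α₀ * Real.exp (-(ρ * tdistT (TGIndex.Mn d hL (ι i)) y y'))) ∧
        HasMaj (BlockNorm.ofBlocks (unitTorusGeo L (ι i).k (TGIndex.Mn d hL (ι i))) (blkFine L (ι i).k (TGIndex.Mn d hL (ι i))))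
          (BlockNorm.ofBlocks (unitTorusGeo L (ι i).k (TGIndex.Mn d hL (ι i))) (fun x : Tor (fine (L ^ (ι i).m * L ^ (ι i).k) (TGIndex.Mn d hL (ι i))) × Fin (d + 1) =>
            blockOf (L ^ (ι i).m * L ^ (ι i).k) (TGIndex.Mn d hL (ι i)) x.1))
          (idef (pull (kingPrV L (ι i).k (ι i).m (TGIndex.Mn d hL (ι i)))) (pull (kingPrV L (ι i).k (ι i).m (TGIndex.Mn d hL (ι i)))) (Wf i U) (Wc i ((pair i).avg U)))
          (fun y y' => mW * θZ ^ (ι i).k * Real.exp (-(ρ * tdistT (TGIndex.Mn d hL (ι i)) y y'))) ∧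
        (∀ κ : Fin (d + 1), HasMaj (BlockNorm.ofBlocks (unitTorusGeo L (ι i).k (TGIndex.Mn d hL (ι i))) (blkFine L (ι i).k (TGIndex.Mn d hL (ι i))))
          (BlockNorm.ofBlocks (unitTorusGeo L (ι i).k (TGIndex.Mn d hL (ι i))) (blkFine L (ι i).k (TGIndex.Mn d hL (ι i))))
          (symbOp (TGIndex.Mn d hL (ι i)) (L ^ (ι i).k) (sD (TGIndex.Mn d hL (ι i)) (L ^ (ι i).k) κ ((L ^ (ι i).k : ℕ) : ℝ)) ∘ₗ Wc i ((pair i).avg U))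
          (fun y y' => βD * α₀ * Real.exp (-(ρ * tdistT (TGIndex.Mn d hL (ι i)) y y')))))
    (Pf : ∀ i, (Bf i).Cfg → Matrix (Idx (TGIndex.Mn d hL (ι i))) (Idx (TGIndex.Mn d hL (ι i))) ℝ)
    (Pc : ∀ i, (Bc i).Cfg → Matrix (Idx (TGIndex.Mn d hL (ι i))) (Idx (TGIndex.Mn d hL (ι i))) ℝ) {γP : ℝ} (hγP : 0 < γP)
    (hP : ∃ δP ζ τ a₁ : ℝ, 0 < δP ∧ 0 < ζ ∧ 0 < τ ∧ 0 < a₁ ∧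
      ∀ (i : I) (α₀ : ℝ), 0 < α₀ → α₀ ≤ a₁ → ∀ U : (Bf i).Cfg, (Bf i).Reg335 c35 α₀ U →
        (∀ p q : Idx (TGIndex.Mn d hL (ι i)), |Pc i ((pair i).avg U) p q| ≤ ζ * α₀ * Real.exp (-(δP * tdist (TGIndex.Mn d hL (ι i)) p q))) ∧
        (∀ p q : Idx (TGIndex.Mn d hL (ι i)), |Pf i U p q| ≤ ζ * α₀ * Real.exp (-(δP * tdist (TGIndex.Mn d hL (ι i)) p q))) ∧
        (∀ p q : Idx (TGIndex.Mn d hL (ι i)), |Pf i U p q - Pc i ((pair i).avg U) p q|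
            ≤ τ * ((L : ℝ) ^ (ι i).k) ^ (-γP) * Real.exp (-(δP * tdist (TGIndex.Mn d hL (ι i)) p q))))
    (ne2At : ∀ {F : T4Family} {D : Datum F N}, key F D → (ℕ → ℝ) → List (ULoop F) → ℕ → NE2Objects₁₁) (RRec : RateRecordPred N)
    (hadm : ∀ (F : T4Family) (D : Datum F N) (g₀ : ℕ → ℝ) (os : List (ULoop F)) (R : RateCarriers N), RRec F D g₀ os R →
      ∃ (h : key F D) (k : ℕ), R.ne2 = ne2OfRecord₁₁ (ne2At h g₀ os k))
    (h : ∀ (F : T4Family) (D : Datum F N) (h : key F D) (g₀ : ℕ → ℝ) (os : List (ULoop F)) (k : ℕ),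
      ne2At h g₀ os k = ⟨I, c35, p, fun i => ⟨tgGeoC d hL (ι i), gf i, Bc i, Bf i, pair i⟩, Kop, tgSiteExOn ι gf Bc Bf d hL aS pair Pf Pc,
        tgCovExOn ι gf Bc Bf d hL b α β pair
          (fun i U => unitBondMat (TGIndex.Mn d hL (ι i)) (qvRe _ (L ^ (ι i).m * L ^ (ι i).k) ∘ₗ (Wf i U ∘ₗ qvAdjRe _ (L ^ (ι i).m * L ^ (ι i).k))))
          (fun i V => unitBondMat (TGIndex.Mn d hL (ι i)) (qvRe _ (L ^ (ι i).k) ∘ₗ (Wc i V ∘ₗ qvAdjRe _ (L ^ (ι i).k)))),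
        fun _ _ => True, fun i => (tgGeoC d hL (ι i)).dist⟩) :
    S_N15 RRec := by
  refine s_N15_of_admits ne2At RRec hadm fun F D hk g₀ os k => ?_
  rw [h F D hk g₀ os k]
  exact n15At_tgExEx_of_incrementLetters (d := d) ι gf Bc Bf hd hLodd hL2 hL hb haS α β hι hM pair p Kop hop Wf Wc hθL hθ1 hW Pf Pc hγP hP

end Summit.QuantumFields.YangMills.BalabanUVNodes.N15.SiteLayerBg

end
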